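import Literature.AlgebraicGeometry.Frobenioids.ModelFrobenioidStandard
import Literature.AlgebraicGeometry.Frobenioids.ModelFrobenioidNormalized
import Literature.AlgebraicGeometry.Frobenioids.ModelFrobenioidPreFrobenioid
import Literature.AlgebraicGeometry.Frobenioids.PreFrobenioidDataOfModel
import HarnessLib

/-!
# Frobenioids I, Theorem 5.2 (ii)/(iii): the type predicates of §3 for a model Frobenioid

Mochizuki, *The geometry of Frobenioids I: the general theory*, Kyushu J. Math. **62** (2008)
293–400, §5, Theorem 5.2 (ii) p. 101 ("`C` is a Frobenioid of isotropic … type") and the proof of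
Theorem 5.2 (iii), p. 102 ("it is immediate from the simple structure of model Frobenioids that
every object is isotropic, Frobenius-isotropic and Frobenius-normalized")
[cite: MochizukiFrdI2008, Thm. 5.2(ii) p.101] [cite: MochizukiFrdI2008, Thm. 5.2(iii) p.102].

This file transports seat abc-iut-found's object-level facts about the model Frobenioid
`ModelFrobenioid Φ B DivB` (`isIsotropic`, `isCoAngular`, `isFrobeniusNormalized`, stated for the
functor `toElem : C → F_Φ`) to seat abc-iut-L1-t3's operations language
`data Φ B DivB = PreFrobenioidData.ofFunctor Φ (toElem Φ B DivB)` in which the §3/§4/§6 statements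
are typed, and records that the second packaging `PreFrobenioidData.ofModel Φ B DivB`
(`PreFrobenioidDataOfModel.lean`, used by the §6 examples) is definitionally the same.  PROVED here,
for `B` group-like: isotropic type, Frobenius-isotropic type (identities are of Frobenius type),
Frobenius-normalized type (unconditionally), "group-like type ⟺ `Φ` is the zero monoid", and the
agreement of the two renderings of "`Φ` non-dilating".  The `iff` of Thm. 5.2 (iii) itself
(which also needs Rem. 3.1.1, hence the Frobenioid axioms) is `ModelFrobenioidStandardProofs.lean`.
-/

namespace Literature.AlgebraicGeometry.Frobenioids

open CategoryTheory Opposite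

universe w v u

namespace ModelFrobenioid

variable {D : Type u} [Category.{v} D] (Φ B : Dᵒᵖ ⥤ CommMonCat.{w}) (DivB : B ⟶ monoidGp Φ)

/-- The two renderings of "`Φ` is non-dilating" (Def. 1.1 (ii)) — through the operations
`data Φ B DivB` of the model Frobenioid (seat abc-iut-L1-t3) and directly on `Φ`
(`ElementaryFrobenioid.lean`) — agree. [cite: MochizukiFrdI2008, Def. 1.1(ii) p.19] -/
theorem data_isNonDilatingOn_iff :
    (data Φ B DivB).IsNonDilatingOn ↔ IsNonDilatingOn Φ := by
  rw [PreFrobenioidData.isNonDilatingOn_iff]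
  refine forall_congr' fun X => forall_congr' fun f => ?_
  show PreFrobenioidData.IsNonDilating (pull Φ f) ↔ IsNonDilating (pull Φ f)
  unfold PreFrobenioidData.IsNonDilating IsNonDilating
  refine imp_congr_right fun _ => ?_
  rw [MonoidHom.ext_iff]
  rfl

/-- "`C` is of group-like type" (every `Φ(A)` is trivial, Def. 1.2 (iv)/(v)) for the model
Frobenioid says exactly "`Φ` is the zero monoid": every `A_D ∈ Ob(D)` is the base of the object
`(A_D, 0)`. [cite: MochizukiFrdI2008, Thm. 5.2(iii) p.101] -/
theorem data_isOfGroupLikeType_iff :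
    (data Φ B DivB).IsOfGroupLikeType ↔ IsZeroMonoid Φ := by
  constructor
  · intro h A x
    exact h.obj (zeroObj Φ B DivB (unop A)) x
  · intro h
    exact ⟨fun A x => h _ x⟩

variable {Φ B DivB}

/-- Every object of a model Frobenioid is isotropic (Thm. 5.2 (ii); seat abc-iut-found), in seat
abc-iut-L1-t3's operations language. [cite: MochizukiFrdI2008, Thm. 5.2(ii) p.101] -/
theorem data_isOfIsotropicType (hBg : Objectwise (fun M _ => IsGroupLike M) B) :
    (data Φ B DivB).IsOfIsotropicType :=
  ⟨fun A => (PreFrobenioidData.ofFunctor_isIsotropic (toElem Φ B DivB) A).mpr (isIsotropic hBg A)⟩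

/-- Identities of a model Frobenioid are of Frobenius type (co-angular — every morphism is —,
isometric, base-isomorphic). [cite: MochizukiFrdI2008, Thm. 5.2(ii) p.101] -/
theorem data_isFrobeniusType_id (hBg : Objectwise (fun M _ => IsGroupLike M) B)
    (A : ModelFrobenioid Φ B DivB) : (data Φ B DivB).IsFrobeniusType (𝟙 A) := by
  refine ⟨⟨(PreFrobenioidData.ofFunctor_isCoAngular (toElem Φ B DivB) (𝟙 A)).mpr
    (isCoAngular hBg (𝟙 A)), (data Φ B DivB).div_id A⟩, ?_⟩
  show IsIso ((data Φ B DivB).base.map (𝟙 A))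
  rw [(data Φ B DivB).base.map_id]
  infer_instance

/-- Every object of a model Frobenioid is Frobenius-isotropic (the identity is a morphism of
Frobenius type to an isotropic object). [cite: MochizukiFrdI2008, Thm. 5.2(iii) p.102] -/
theorem data_isOfFrobeniusIsotropicType (hBg : Objectwise (fun M _ => IsGroupLike M) B) :
    (data Φ B DivB).IsOfFrobeniusIsotropicType :=
  ⟨fun A => ⟨A, 𝟙 A, data_isFrobeniusType_id hBg A, (data_isOfIsotropicType hBg).obj A⟩⟩

/-- Every object of a model Frobenioid is Frobenius-normalized (seat abc-iut-found's
`ModelFrobenioid.isFrobeniusNormalized`), in seat abc-iut-L1-t3's operations language.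
[cite: MochizukiFrdI2008, Thm. 5.2(iii) p.102] -/
theorem data_isOfFrobeniusNormalizedType :
    (data Φ B DivB).IsOfFrobeniusNormalizedType :=
  ⟨fun A φ hφ α hα => isFrobeniusNormalized A φ hφ α hα⟩

variable (Φ B DivB)

/-- The two packagings of the model Frobenioid's operations `(Base, Div, deg_Fr)` in the tree —
`PreFrobenioidData.ofModel Φ B DivB` (`PreFrobenioidDataOfModel.lean`, used by the §6 files) and
`data Φ B DivB = PreFrobenioidData.ofFunctor Φ (toElem Φ B DivB)` (`ModelFrobenioidStandard.lean`) —
are the same, definitionally. [cite: MochizukiFrdI2008, Thm. 5.2(i) p.100] -/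
theorem ofModel_eq_data : PreFrobenioidData.ofModel Φ B DivB = data Φ B DivB := rfl

/-- Hence every §3 type predicate transfers verbatim; in particular (for the §6 examples, which are
typed over `ofModel`): a model Frobenioid with group-like `B` is of isotropic type.
[cite: MochizukiFrdI2008, Thm. 5.2(ii) p.101] -/
theorem ofModel_isOfIsotropicType (hBg : Objectwise (fun M _ => IsGroupLike M) B) :
    (PreFrobenioidData.ofModel Φ B DivB).IsOfIsotropicType :=
  data_isOfIsotropicType hBg

end ModelFrobenioid

end Literature.AlgebraicGeometry.Frobenioids
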